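import Mathlib
import Summits.KontsevichZagierPeriods.Zeta5Search.BrickHatLocality
import Summits.KontsevichZagierPeriods.Zeta5Search.BrickPropositionH

/-!
# BrickHatWeight — zi-p2's THEOREM 9 LEMMA 9.3: the BLOCK WEIGHT `Ŵ(j) = Σ_{i=1}^{p−1} Λ°_{jp+i}` of the off-digit
cells is EXACTLY antisymmetric, digit-local, and `≡ 0 (mod p)`; hence `g₀ = ŵ·P_0` is an ADMISSIBLE weight for the row
`n − 1` of the symmetric kernel and PROPOSITION H° applies to it (cell zeta5-irr)

HONEST FRAMING: systematic search; no irrationality claim unless certified. INSTRUMENT lemmas of the ζ(5)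
census cell zeta5-irr (HOME `run/shared/lean/pub/zeta5-irr/`; memo `zi-p2/probes/B8/thm9/THEOREM9.md` (sealed
eae326393abac726) §2 (ii) «BLOCK WEIGHT LAWS (no level hypothesis). Ŵ(n−1−j) = −Ŵ(j) EXACTLY; Ŵ(j + p^et) ≡ Ŵ(j)
(mod p^{e+1}) …; in particular ŵ = Ŵ/p maps {0,…,n−1} to ℤ_(p), ŵ(n−1−j) = −ŵ(j), ŵ(j*) ≡ ŵ(j) (mod p^e) … so g₀ = ŵ·P_0
is an ADMISSIBLE weight for the row M = n−1 of R̃ in the sense of THEOREM8», LEMMA 9.3). DESIGN NOTE: `Ŵ ≡ 0 (mod p)` is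
obtained here WITHOUT the residue `Λ°_K ≡ −i^{1−A}` and without power sums: exact antisymmetry plus DEPTH-ONE Wilson
locality between any two blocks give `Ŵ(m−j) = −Ŵ(j) ≡ Ŵ(j) (mod p)`, `p` odd (the `S₀ + S₀` device of
`BrickBlockWeight.oneDigitSum_le`). Nothing here is about ζ(5); no irrationality content; filing moves no rung. Filed by
the engine seat zi-eng (g10); inputs `BrickHatMultiplier` (closed form, antisymmetry), `BrickHatLocality` (locality),
`BrickPropositionH.propositionH`.

## The statements (`p` odd prime, `A` even, `2B ≤ A`, row `np` with `n = m + 1`, blocks `j ≤ m`)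

* `hatW A B p m j = Σ_{t < p−1} Λ°_{jp+(t+1)}` (= zi-p2's `Ŵ(j)`); `hatW_reflect` (`Ŵ(m−J) = −Ŵ(J)` exactly),
  `hatW_local_std` (`v(Ŵ(j') − Ŵ(j)) ≤ exp(−e)` for `j'p = jp + p^e q`, `e ≥ 1`), `hatW_sub_le` (any two blocks,
  `exp(−1)`), **`hatW_le`** (`v(Ŵ(j)) ≤ exp(−1)`, i.e. `Ŵ ≡ 0 (mod p)`); `padicValuation_hatPoly_coeff_le`,
  `padicValuation_hatPoly_eval_zero_sub_le` (`Ê_j ∈ ℤ[X]`, `Ê_k(0)` an integer polynomial in `k`).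
* `hatG A B p m j = Ŵ(j)·n^{A−2B}·Ê_j(0)/p` (= zi-p2's `g₀ = ŵ·P_0`, `P_0(j) = n^{A−2B}Ê_j(0)`): `hatG_le_one`,
  `hatG_reflect_add` (`g₀(m−k) + g₀(k) = 0`), `hatG_local` (`v(g₀(k') − g₀(k)) ≤ exp(−e)` for `p^e ∣ k − k'`) — the three
  admissibility hypotheses of `BrickPropositionH.propositionH`, and **`propositionH_hatG`**: H° for `(m, g₀)` at every
  level `ℓ ≤ A` with `m < p^{ℓ+1}` (`1 ≤ B`).
-/

namespace Summit.KontsevichZagierPeriods.Zeta5Search.BrickHatWeight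

open Finset Nat Polynomial WithZero
open Summit.KontsevichZagierPeriods.Zeta5Search.BrickLaurent (cell)
open Summit.KontsevichZagierPeriods.Zeta5Search.BrickPartialFractions (cellZero)
open Summit.KontsevichZagierPeriods.Zeta5Search.BrickLambda (padicValuation_two)
open Summit.KontsevichZagierPeriods.Zeta5Search.BrickResidueLawMain (cong_mul_le)
open Summit.KontsevichZagierPeriods.Zeta5Search.BrickLambdaLocality (cong_pow_le)
open Summit.KontsevichZagierPeriods.Zeta5Search.BrickHatStrip (hatPoly isSlopeInt_hatPoly)
open Summit.KontsevichZagierPeriods.Zeta5Search.BrickHatMultiplier (hatLam hatLam_reflect padicValuation_hatLam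
  hatPoly_eval_zero_reflect)
open Summit.KontsevichZagierPeriods.Zeta5Search.BrickHatLocality (hatLam_local_std)
open Summit.KontsevichZagierPeriods.Zeta5Search.BrickPropositionH (padicValuation_div_prime_le propositionH)
open Literature.NumberTheory.LFunctions (padicValuation_natCast_le_one)

variable {p : ℕ} [Fact p.Prime]

/-- An integer divisible by `p^e` has valuation `≤ exp(−e)` in `ℚ`. -/
theorem padicValuation_intCast_le_of_dvd {e : ℕ} {z : ℤ} (h : (p : ℤ) ^ e ∣ z) :
    Rat.padicValuation p (z : ℚ) ≤ exp (-(e : ℤ)) := by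
  obtain ⟨c, rfl⟩ := h
  push_cast
  rw [map_mul, map_pow, Rat.padicValuation_self, ← exp_nsmul, nsmul_eq_mul, mul_neg_one, Rat.padicValuation_cast]
  calc _ ≤ exp (-(e : ℤ)) * 1 := mul_le_mul' le_rfl (Int.padicValuation_le_one _ _)
    _ = _ := mul_one _

/-! ## The block weight `Ŵ` -/

/-- zi-p2's BLOCK WEIGHT of the off-digit cells of block `j` of the row `np` (`n = m+1`):
`hatW = Σ_{i=1}^{p−1} Λ°_{jp+i}` (written as a sum over `t = i − 1 < p − 1`). -/
noncomputable def hatW (A B p m j : ℕ) : ℚ := ∑ t ∈ range (p - 1), hatLam A B p m j (t + 1)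

omit [Fact p.Prime] in
/-- **LEMMA 9.3, exact antisymmetry**: `Ŵ(m−J) = −Ŵ(J)` (`m = J + M`; reflect the digit `i ↦ p − i`, `A` even). -/
theorem hatW_reflect {A : ℕ} (hA : Even A) (B J M : ℕ) : hatW A B p (J + M) M = -hatW A B p (J + M) J := by
  unfold hatW
  rw [← Finset.sum_range_reflect (fun t => hatLam A B p (J + M) M (t + 1)) (p - 1), ← Finset.sum_neg_distrib]
  refine Finset.sum_congr rfl fun t ht => ?_
  have ht' := mem_range.1 ht
  exact hatLam_reflect hA B (i := t + 1) (i' := p - 1 - 1 - t + 1) (by omega) J M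

section laws

variable (hp2 : p ≠ 2) {A B : ℕ} (hA : Even A) (hAB : 2 * B ≤ A)
include hp2 hA hAB

/-- **LEMMA 9.3, digit-locality**: `v(Ŵ(j') − Ŵ(j)) ≤ exp(−e)` for blocks `j, j' ≤ m` with `j'p = jp + p^e·q`, `e ≥ 1`
(termwise `BrickHatLocality.hatLam_local_std`). -/
theorem hatW_local_std {m j j' e q : ℕ} (hj : j ≤ m) (hj' : j' ≤ m) (hq : j' * p = j * p + p ^ e * q) (he : 1 ≤ e) :
    Rat.padicValuation p (hatW A B p m j' - hatW A B p m j) ≤ exp (-(e : ℤ)) := by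
  unfold hatW
  rw [← Finset.sum_sub_distrib]
  refine Valuation.map_sum_le _ fun t ht => ?_
  have ht' := mem_range.1 ht
  exact hatLam_local_std hp2 hA hAB (by omega) (by omega) hj hj' hq he

/-- Depth one between ANY two blocks: `v(Ŵ(j₂) − Ŵ(j₁)) ≤ exp(−1)` (`j₁, j₂ ≤ m`). -/
theorem hatW_sub_le {m j₁ j₂ : ℕ} (hj₁ : j₁ ≤ m) (hj₂ : j₂ ≤ m) :
    Rat.padicValuation p (hatW A B p m j₂ - hatW A B p m j₁) ≤ exp (-1 : ℤ) := by
  wlog hle : j₁ ≤ j₂ generalizing j₁ j₂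
  · rw [Valuation.map_sub_swap]; exact this hj₂ hj₁ (by omega)
  obtain ⟨d, rfl⟩ := Nat.exists_eq_add_of_le hle
  exact_mod_cast hatW_local_std hp2 hA hAB hj₁ hj₂ (e := 1) (q := d) (by ring) le_rfl

/-- **LEMMA 9.3, `Ŵ ≡ 0 (mod p)`**: `v(Ŵ(j)) ≤ exp(−1)` for every block `j ≤ m` (`Ŵ(m−j) = −Ŵ(j)` exactly and
`Ŵ(m−j) ≡ Ŵ(j) (mod p)` by depth-one locality; `p` odd). -/
theorem hatW_le {m j : ℕ} (hj : j ≤ m) : Rat.padicValuation p (hatW A B p m j) ≤ exp (-1 : ℤ) := by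
  obtain ⟨M, rfl⟩ := Nat.exists_eq_add_of_le hj
  have h1 := hatW_sub_le hp2 hA hAB (m := j + M) (j₁ := j) (j₂ := M) hj (Nat.le_add_left M j)
  rw [hatW_reflect hA B j M, show -hatW A B p (j + M) j - hatW A B p (j + M) j = -(2 * hatW A B p (j + M) j) by ring,
    Valuation.map_neg, map_mul, padicValuation_two hp2, one_mul] at h1
  exact h1

/-- `Ŵ(j) ∈ ℤ_(p)`. -/
theorem hatW_le_one {m j : ℕ} (hj : j ≤ m) : Rat.padicValuation p (hatW A B p m j) ≤ 1 :=
  (hatW_le hp2 hA hAB hj).trans (by rw [← exp_zero, exp_le_exp]; norm_num)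

end laws

/-! ## The hat factor at `0` as an integer polynomial in the block index -/

/-- The coefficients of `Ê_j` are `p`-integral: `v([X^h]Ê_j) ≤ 1`. -/
theorem padicValuation_hatPoly_coeff_le (B m j h : ℕ) : Rat.padicValuation p ((hatPoly B m j).coeff h) ≤ 1 := by
  have := isSlopeInt_hatPoly (p := p) B m j h
  rwa [zero_mul, zero_add, exp_zero, Polynomial.coeff_coe] at this

/-- `v(Ê_j(0)) ≤ 1`. -/
theorem padicValuation_hatPoly_eval_zero_le (B m j : ℕ) : Rat.padicValuation p ((hatPoly B m j).eval 0) ≤ 1 := by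
  rw [← coeff_zero_eq_eval_zero]; exact padicValuation_hatPoly_coeff_le B m j 0

/-- `v(Ê_{k'}(0) − Ê_k(0)) ≤ exp(−e)` whenever `p^e ∣ k − k'` (`Ê_k(0) = (−(k+n))^B(m+n−k)^B` is an integer polynomial
in `k`). -/
theorem padicValuation_hatPoly_eval_zero_sub_le (B m : ℕ) {k k' e : ℕ} (hdvd : (p : ℤ) ^ e ∣ (k : ℤ) - k') :
    Rat.padicValuation p ((hatPoly B m k').eval 0 - (hatPoly B m k).eval 0) ≤ exp (-(e : ℤ)) := by
  unfold hatPoly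
  simp only [eval_mul, eval_pow, eval_add, eval_X, eval_C, zero_add]
  have h1 : Rat.padicValuation p (-((k' : ℚ) + ((m + 1 : ℕ) : ℚ)) - -((k : ℚ) + ((m + 1 : ℕ) : ℚ))) ≤ exp (-(e : ℤ)) := by
    rw [show -((k' : ℚ) + ((m + 1 : ℕ) : ℚ)) - -((k : ℚ) + ((m + 1 : ℕ) : ℚ)) = (((k : ℤ) - k' : ℤ) : ℚ) by
      push_cast; ring]
    exact padicValuation_intCast_le_of_dvd hdvd
  have h2 : Rat.padicValuation p (((m : ℚ) + ((m + 1 : ℕ) : ℚ) - k') - ((m : ℚ) + ((m + 1 : ℕ) : ℚ) - k)) ≤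
      exp (-(e : ℤ)) := by
    rw [show ((m : ℚ) + ((m + 1 : ℕ) : ℚ) - k') - ((m : ℚ) + ((m + 1 : ℕ) : ℚ) - k) = (((k : ℤ) - k' : ℤ) : ℚ) by
      push_cast; ring]
    exact padicValuation_intCast_le_of_dvd hdvd
  have i1 : ∀ x : ℕ, Rat.padicValuation p (-((x : ℚ) + ((m + 1 : ℕ) : ℚ))) ≤ 1 := fun x => by
    rw [Valuation.map_neg, ← Nat.cast_add]; exact padicValuation_natCast_le_one _
  have i2 : ∀ x : ℕ, Rat.padicValuation p ((m : ℚ) + ((m + 1 : ℕ) : ℚ) - x) ≤ 1 := fun x => by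
    rw [show (m : ℚ) + ((m + 1 : ℕ) : ℚ) - x = (((m : ℤ) + (m + 1 : ℕ) - x : ℤ) : ℚ) by push_cast; ring,
      Rat.padicValuation_cast]
    exact Int.padicValuation_le_one _ _
  refine cong_mul_le (cong_pow_le h1 (i1 k') (i1 k) B) (cong_pow_le h2 (i2 k') (i2 k) B) ?_ ?_
  · rw [map_pow]; exact pow_le_one' (i1 k') B
  · rw [map_pow]; exact pow_le_one' (i2 k) B

/-! ## The admissible weight `g₀ = ŵ·P_0` -/

/-- zi-p2's TOP WEIGHT of THEOREM 9 on the row `m = n − 1` of `R̃`: `g₀(j) = Ŵ(j)·n^{A−2B}·Ê_j(0)/p = ŵ(j)·P_0(j)`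
(`ŵ = Ŵ/p`, `P_0(j) = P(−j) = n^{A−2B}Ê_j(0)`). -/
noncomputable def hatG (A B p m j : ℕ) : ℚ :=
  hatW A B p m j * ((((m + 1 : ℕ) : ℚ)) ^ (A - 2 * B) * (hatPoly B m j).eval 0) / p

omit [Fact p.Prime] in
/-- (S), exact: `g₀(m−k) + g₀(k) = 0` (`A` even). -/
theorem hatG_reflect_add {A : ℕ} (hA : Even A) (B : ℕ) {m k : ℕ} (hk : k ≤ m) :
    hatG A B p m (m - k) + hatG A B p m k = 0 := by
  obtain ⟨M, rfl⟩ := Nat.exists_eq_add_of_le hk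
  rw [Nat.add_sub_cancel_left, hatG, hatG, hatW_reflect hA B k M, hatPoly_eval_zero_reflect]
  ring

section admissible

variable (hp2 : p ≠ 2) {A B : ℕ} (hA : Even A) (hAB : 2 * B ≤ A)
include hp2 hA hAB

/-- (I): `g₀(j) ∈ ℤ_(p)` (`Ŵ ≡ 0 (mod p)` pays for the division by `p`). -/
theorem hatG_le_one {m j : ℕ} (hj : j ≤ m) : Rat.padicValuation p (hatG A B p m j) ≤ 1 := by
  have h : Rat.padicValuation p (hatW A B p m j * ((((m + 1 : ℕ) : ℚ)) ^ (A - 2 * B) * (hatPoly B m j).eval 0)) ≤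
      exp (-1 : ℤ) := by
    rw [map_mul, map_mul, map_pow]
    calc _ ≤ exp (-1 : ℤ) * 1 := mul_le_mul' (hatW_le hp2 hA hAB hj)
          (mul_le_one' (pow_le_one' (padicValuation_natCast_le_one _) _) (padicValuation_hatPoly_eval_zero_le B m j))
      _ = _ := mul_one _
  have h' := padicValuation_div_prime_le (p := p) h
  rwa [show (-1 : ℤ) + 1 = 0 by norm_num, exp_zero] at h'

/-- (D): `v(g₀(k') − g₀(k)) ≤ exp(−e)` for `k, k' ≤ m` with `p^e ∣ k − k'`, `e ≥ 1` (`Ŵ` is local to depth `e+1` between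
such blocks, `Ŵ ≡ 0 (mod p)`, and `Ê_k(0)` is an integer polynomial in `k`). -/
theorem hatG_local {m e k k' : ℕ} (he : 1 ≤ e) (hk : k ≤ m) (hk' : k' ≤ m) (hdvd : (p : ℤ) ^ e ∣ (k : ℤ) - k') :
    Rat.padicValuation p (hatG A B p m k' - hatG A B p m k) ≤ exp (-(e : ℤ)) := by
  have hp : p.Prime := Fact.out
  wlog hle : k ≤ k' generalizing k k'
  · rw [Valuation.map_sub_swap]
    exact this hk' hk (by rw [← neg_sub]; exact (dvd_neg).2 hdvd) (by omega)
  obtain ⟨d, rfl⟩ := Nat.exists_eq_add_of_le hle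
  obtain ⟨q, hq⟩ : p ^ e ∣ d := by
    have : (p : ℤ) ^ e ∣ (d : ℤ) := by
      have h := (dvd_neg).2 hdvd
      rw [neg_sub] at h; push_cast at h; rwa [add_sub_cancel_left] at h
    exact_mod_cast this
  -- the block weights agree to depth `e + 1`, the hat factors to depth `e`
  have hW := hatW_local_std hp2 hA hAB hk hk' (e := e + 1) (q := q) (by rw [hq]; ring) (by omega)
  have hE := padicValuation_hatPoly_eval_zero_sub_le (p := p) B m hdvd
  have hprod : Rat.padicValuation p (hatW A B p m (k + d) * (hatPoly B m (k + d)).eval 0 -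
      hatW A B p m k * (hatPoly B m k).eval 0) ≤ exp (-((e : ℤ) + 1)) := by
    rw [show hatW A B p m (k + d) * (hatPoly B m (k + d)).eval 0 - hatW A B p m k * (hatPoly B m k).eval 0 =
      hatW A B p m (k + d) * ((hatPoly B m (k + d)).eval 0 - (hatPoly B m k).eval 0) +
        (hatW A B p m (k + d) - hatW A B p m k) * (hatPoly B m k).eval 0 by ring]
    refine Valuation.map_add_le _ ?_ ?_
    · rw [map_mul]
      calc _ ≤ exp (-1 : ℤ) * exp (-(e : ℤ)) := mul_le_mul' (hatW_le hp2 hA hAB hk') hE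
        _ = _ := by rw [← exp_add]; congr 1; ring
    · rw [map_mul]
      calc _ ≤ exp (-((e + 1 : ℕ) : ℤ)) * 1 := mul_le_mul' hW (padicValuation_hatPoly_eval_zero_le B m k)
        _ = _ := by rw [mul_one]; push_cast; ring_nf
  have hN : Rat.padicValuation p ((((m + 1 : ℕ) : ℚ)) ^ (A - 2 * B)) ≤ 1 := by
    rw [map_pow]; exact pow_le_one' (padicValuation_natCast_le_one _) _
  have h := padicValuation_div_prime_le (p := p) (x := (((m + 1 : ℕ) : ℚ)) ^ (A - 2 * B) *
    (hatW A B p m (k + d) * (hatPoly B m (k + d)).eval 0 - hatW A B p m k * (hatPoly B m k).eval 0))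
    (m := -((e : ℤ) + 1)) (by
      rw [map_mul]
      calc _ ≤ 1 * exp (-((e : ℤ) + 1)) := mul_le_mul' hN hprod
        _ = _ := one_mul _)
  rw [show -((e : ℤ) + 1) + 1 = -(e : ℤ) by ring] at h
  rw [show hatG A B p m (k + d) - hatG A B p m k = (((m + 1 : ℕ) : ℚ)) ^ (A - 2 * B) *
    (hatW A B p m (k + d) * (hatPoly B m (k + d)).eval 0 - hatW A B p m k * (hatPoly B m k).eval 0) / p by
      unfold hatG; ring]
  exact h

/-- **PROPOSITION H° for the hat weight** (zi-p2 THEOREM 9, proof of (iv): «g₀ is admissible for M (LEMMA 9.3), so this is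
PROPOSITION H°(L) for the row M of R̃»): for `p` odd, `A` even, `1 ≤ B`, `2B ≤ A`, every level `ℓ ≤ A` and `m < p^{ℓ+1}`:
`v(Σ_{k≤m} g₀(k)·p^{ℓ(A−s)}c̃_{k,s}(m)) ≤ exp(−ℓ)` for every `s`, and the same for the harmonic cell. -/
theorem propositionH_hatG (hB : 1 ≤ B) {ℓ m : ℕ} (hℓ : ℓ ≤ A) (hm : m < p ^ (ℓ + 1)) :
    (∀ s, Rat.padicValuation p (∑ k ∈ range (m + 1),
      hatG A B p m k * ((p : ℚ) ^ (ℓ * (A - s)) * cell A B 0 m k s)) ≤ exp (-(ℓ : ℤ))) ∧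
    Rat.padicValuation p (∑ k ∈ range (m + 1), hatG A B p m k * ((p : ℚ) ^ (ℓ * A) * cellZero A B 0 m k)) ≤
      exp (-(ℓ : ℤ)) :=
  propositionH hp2 hA hB hAB ℓ hℓ m hm (hatG A B p m) (fun _ hk => hatG_le_one hp2 hA hAB hk)
    (fun k hk => by rw [hatG_reflect_add hA B hk, map_zero]; exact _root_.zero_le)
    (fun _ _ _ he _ hk hk' hdvd => hatG_local hp2 hA hAB he hk hk' hdvd)

end admissible

end Summit.KontsevichZagierPeriods.Zeta5Search.BrickHatWeight
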